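import Mathlib
import Summits.Ventures.PercRepro.TriangleCapRegularCellSeven

/-!
# PercRepro — THE REGULAR CELL `t = 8 D` ON `9 + (s − t)` VERTICES, EXACTLY: `{bottom, bottom + 7, bottom + 12, bottom + 13} ∪ [bottom + 14, bottom + 28 D]`
(p3, gen 55; part 310)

At `ℓ = 8` the row excess `Σ_{rows} k (8 − k)` is `0`, `14` or at least `24` (parts 290–291) and at most `56 D`; the
single-block values (rows of eight edges) are `E₁(8) = {0, 7, 12, 13, 15, …, 28}` and `14 = 7 + 7` needs two blocks
`(7,1)` — so every `14 ≤ m ≤ 28 D` is realised (blocks of eight edges for `15 … 28`, of sixteen for `14` and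
`29 … 56`, `m = 28 a + e`, `a = min(⌊(m − 14)/28⌋, D − 2)`, `e ∈ [14, 56]`; `rows_of_excess_eight`), and `12`, `13` by
`(6,2)`, `(6,1,1)`.  THEOREM (`regular_cell_eight`, `8 ≤ D`, `t = 8 D`, `2 t ≤ s`): `j` is the band value of a
triangle-free graph on `9 + (s − t)` vertices with `s` edges, a vertex of degree `s − t` and every off-degree `≤ D`
IFF `j − bottomReg 8 D ∈ {0, 7, 12, 13} ∪ [14, 28 D]` — the excess set at `ℓ = 8` misses exactly `{1, …, 6, 8, …, 11}`
(no third gap: the two-block value `14` fills it).  Axioms: standard.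
-/

namespace PercRepro

namespace TriangleCap

namespace C047

open Finset

/-- The entries of a list in `[1, 8]` give a sequence in `[1, 8]` below the length. -/
theorem getD_bounds_eight (L : List ℕ) (hL : ∀ x ∈ L, 1 ≤ x ∧ x ≤ 8) (i : ℕ) (hi : i < L.length) :
    1 ≤ L.getD i 0 ∧ L.getD i 0 ≤ 8 := by
  rw [List.getD_eq_getElem L 0 hi]
  exact hL _ (List.getElem_mem hi)

/-- The block of excess `e ∈ {7, 12, 13} ∪ [14, 56]` (rows of eight or sixteen edges): its sizes. -/
def blockEight (e : ℕ) : List ℕ :=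
  if e = 7 then [7, 1]
  else if e = 12 then [6, 2]
  else if e = 13 then [6, 1, 1]
  else if e = 14 then [7, 7, 1, 1]
  else if e = 15 then [5, 3]
  else if e = 16 then [4, 4]
  else if e = 17 then [5, 2, 1]
  else if e = 18 then [5, 1, 1, 1]
  else if e = 19 then [4, 3, 1]
  else if e = 20 then [4, 2, 2]
  else if e = 21 then [4, 2, 1, 1]
  else if e = 22 then [4, 1, 1, 1, 1]
  else if e = 23 then [3, 2, 2, 1]
  else if e = 24 then [3, 2, 1, 1, 1]
  else if e = 25 then [3, 1, 1, 1, 1, 1]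
  else if e = 26 then [2, 2, 1, 1, 1, 1]
  else if e = 27 then [2, 1, 1, 1, 1, 1, 1]
  else if e = 28 then [1, 1, 1, 1, 1, 1, 1, 1]
  else if e = 29 then [7, 4, 1, 1, 1, 1, 1]
  else if e = 30 then [7, 3, 2, 2, 1, 1]
  else if e = 31 then [7, 3, 2, 1, 1, 1, 1]
  else if e = 32 then [7, 3, 1, 1, 1, 1, 1, 1]
  else if e = 33 then [7, 2, 2, 1, 1, 1, 1, 1]
  else if e = 34 then [7, 2, 1, 1, 1, 1, 1, 1, 1]
  else if e = 35 then [7, 1, 1, 1, 1, 1, 1, 1, 1, 1]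
  else if e = 36 then [6, 3, 2, 2, 1, 1, 1]
  else if e = 37 then [6, 3, 2, 1, 1, 1, 1, 1]
  else if e = 38 then [6, 3, 1, 1, 1, 1, 1, 1, 1]
  else if e = 39 then [6, 2, 2, 1, 1, 1, 1, 1, 1]
  else if e = 40 then [6, 2, 1, 1, 1, 1, 1, 1, 1, 1]
  else if e = 41 then [6, 1, 1, 1, 1, 1, 1, 1, 1, 1, 1]
  else if e = 42 then [5, 3, 2, 1, 1, 1, 1, 1, 1]
  else if e = 43 then [5, 3, 1, 1, 1, 1, 1, 1, 1, 1]
  else if e = 44 then [5, 2, 2, 1, 1, 1, 1, 1, 1, 1]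
  else if e = 45 then [5, 2, 1, 1, 1, 1, 1, 1, 1, 1, 1]
  else if e = 46 then [5, 1, 1, 1, 1, 1, 1, 1, 1, 1, 1, 1]
  else if e = 47 then [4, 3, 1, 1, 1, 1, 1, 1, 1, 1, 1]
  else if e = 48 then [4, 2, 2, 1, 1, 1, 1, 1, 1, 1, 1]
  else if e = 49 then [4, 2, 1, 1, 1, 1, 1, 1, 1, 1, 1, 1]
  else if e = 50 then [4, 1, 1, 1, 1, 1, 1, 1, 1, 1, 1, 1, 1]
  else if e = 51 then [3, 2, 2, 1, 1, 1, 1, 1, 1, 1, 1, 1]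
  else if e = 52 then [3, 2, 1, 1, 1, 1, 1, 1, 1, 1, 1, 1, 1]
  else if e = 53 then [3, 1, 1, 1, 1, 1, 1, 1, 1, 1, 1, 1, 1, 1]
  else if e = 54 then [2, 2, 1, 1, 1, 1, 1, 1, 1, 1, 1, 1, 1, 1]
  else if e = 55 then [2, 1, 1, 1, 1, 1, 1, 1, 1, 1, 1, 1, 1, 1, 1]
  else [1, 1, 1, 1, 1, 1, 1, 1, 1, 1, 1, 1, 1, 1, 1, 1]

/-- The facts about a block: entries in `[1, 8]`, sum `8` or `16`, excess `Σ k (8 − k) = 2 e`. -/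
theorem blockEight_facts (e : ℕ) (he : e = 7 ∨ e = 12 ∨ e = 13 ∨ (14 ≤ e ∧ e ≤ 56)) :
    (∀ x ∈ blockEight e, 1 ≤ x ∧ x ≤ 8) ∧ ((blockEight e).sum = 8 ∨ (blockEight e).sum = 16) ∧
      ((blockEight e).map (fun k => k * (8 - k))).sum = 2 * e := by
  unfold blockEight
  rcases he with rfl | rfl | rfl | ⟨he1, he2⟩
  · simp
  · simp
  · simp
  · interval_cases e <;> simp

/-- **THE ROWS OF EVERY EXCESS AT `ℓ = 8`:** for `m ∈ {7, 12, 13}` or `14 ≤ m ≤ 28 D` (`2 ≤ D`) there are row sizes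
`1 ≤ k i ≤ 8`, `i < N`, with `Σ k = 8 D` and `Σ k (8 − k) = 2 m`. -/
theorem rows_of_excess_eight (D m : ℕ) (hD : 2 ≤ D)
    (hm : m = 7 ∨ m = 12 ∨ m = 13 ∨ (14 ≤ m ∧ m ≤ 28 * D)) :
    ∃ (N : ℕ) (k : ℕ → ℕ), (∀ i, i < N → 1 ≤ k i ∧ k i ≤ 8) ∧ ∑ i ∈ range N, k i = 8 * D ∧
      ∑ i ∈ range N, k i * (8 - k i) = 2 * m := by
  -- `a` blocks `(1^8)`, the block of `e`, and full rows
  obtain ⟨a, e, hae, he, haD⟩ : ∃ a e, m = 28 * a + e ∧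
      (e = 7 ∨ e = 12 ∨ e = 13 ∨ (14 ≤ e ∧ e ≤ 56)) ∧ a + 2 ≤ D := by
    rcases hm with rfl | rfl | rfl | ⟨hm1, hm2⟩
    · exact ⟨0, 7, by ring, by omega, by omega⟩
    · exact ⟨0, 12, by ring, by omega, by omega⟩
    · exact ⟨0, 13, by ring, by omega, by omega⟩
    · refine ⟨min ((m - 14) / 28) (D - 2), m - 28 * min ((m - 14) / 28) (D - 2), by omega, ?_, by omega⟩
      right; right; right
      omega
  obtain ⟨hb1, hb2, hb5⟩ := blockEight_facts e he
  set B := blockEight e with hB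
  set c := B.sum / 8 with hc
  have hc' : B.sum = 8 * c := by
    rcases hb2 with h | h <;> rw [h] at hc ⊢ <;> omega
  have hcD : a + c ≤ D := by
    rcases hb2 with h | h <;> rw [h] at hc <;> omega
  set L := List.replicate (8 * a) 1 ++ B ++ List.replicate (D - a - c) 8 with hL
  have hLmem : ∀ x ∈ L, 1 ≤ x ∧ x ≤ 8 := by
    intro x hx
    rw [hL, List.mem_append, List.mem_append, List.mem_replicate, List.mem_replicate] at hx
    rcases hx with (hx | hx) | hx
    · omega
    · exact hb1 x hx
    · omega
  refine ⟨L.length, fun i => L.getD i 0, fun i hi => getD_bounds_eight L hLmem i hi, ?_, ?_⟩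
  · rw [sum_range_getD L (fun x => x), hL, List.map_append, List.map_append, List.sum_append, List.sum_append,
      List.map_id', List.map_id', List.map_id', List.sum_replicate, List.sum_replicate, hc']
    simp only [smul_eq_mul]
    omega
  · rw [sum_range_getD L (fun k => k * (8 - k)), hL, List.map_append, List.map_append, List.sum_append,
      List.sum_append, List.map_replicate, List.map_replicate, List.sum_replicate, List.sum_replicate, hb5]
    simp only [smul_eq_mul]
    omega

/-- The excess of a row is at most seven times its size: `k (8 − k) ≤ 7 k`. -/
theorem excess_le_seven_mul (k : ℕ) : k * (8 - k) ≤ 7 * k := by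
  rcases Nat.lt_or_ge k 8 with h | h
  · interval_cases k <;> omega
  · rw [Nat.sub_eq_zero_of_le h, mul_zero]
    exact Nat.zero_le _

/-- **THE REGULAR CELL `t = 8 D`, EXACTLY:** for `8 ≤ D`, `t = 8 D`, `2 t ≤ s`, `j` is the band value of a
triangle-free graph on `9 + (s − t)` vertices with `s` edges, a vertex of degree `s − t` and every off-degree `≤ D`
IFF `j − bottomReg 8 D ∈ {0, 7, 12, 13} ∪ [14, 28 D]`. -/
theorem regular_cell_eight (s t D j : ℕ) (hD : 8 ≤ D) (ht : t = 8 * D) (hs : 2 * t ≤ s) :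
    (∃ (H : SimpleGraph (Fin (8 + 1 + (s - t)))) (_ : DecidableRel H.Adj), H.CliqueFree 3 ∧
      H.edgeFinset.card = s ∧ ∃ w, deg H w + t = s ∧ (∀ v, offDeg H w v ≤ D) ∧
        ∑ v, deg H v * deg H v + 2 * (t * (s - t - 1)) + 2 * j = s * (s + 1)) ↔
    (j = bottomReg 8 D ∨ j = bottomReg 8 D + 7 ∨ j = bottomReg 8 D + 12 ∨ j = bottomReg 8 D + 13 ∨
      (bottomReg 8 D + 14 ≤ j ∧ j ≤ bottomReg 8 D + 28 * D)) := by
  subst ht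
  have hb := two_mul_bottomReg 8 D (by norm_num) hD
  constructor
  · intro hj
    obtain ⟨N, k, hk, hsum, hid⟩ := (regular_cell_iff s (8 * D) 8 D j (by norm_num) hD rfl hs).mp hj
    have hup : ∑ i ∈ range N, k i * (8 - k i) ≤ 56 * D := by
      calc ∑ i ∈ range N, k i * (8 - k i) ≤ ∑ i ∈ range N, 7 * k i := sum_le_sum (fun i _ => excess_le_seven_mul (k i))
        _ = 7 * ∑ i ∈ range N, k i := by rw [mul_sum]
        _ = 56 * D := by rw [hsum]; ring
    rcases row_excess_trichotomy 8 D k N (by norm_num) (fun m hm => (hk m hm).1) (fun m hm => (hk m hm).2) hsum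
      with h0 | h1 | h2
    · left
      omega
    · right; left
      omega
    · omega
  · intro hj
    have hval : ∀ m, (m = 7 ∨ m = 12 ∨ m = 13 ∨ (14 ≤ m ∧ m ≤ 28 * D)) →
        (∃ (H : SimpleGraph (Fin (8 + 1 + (s - 8 * D)))) (_ : DecidableRel H.Adj), H.CliqueFree 3 ∧
          H.edgeFinset.card = s ∧ ∃ w, deg H w + 8 * D = s ∧ (∀ v, offDeg H w v ≤ D) ∧
            ∑ v, deg H v * deg H v + 2 * (8 * D * (s - 8 * D - 1)) + 2 * (bottomReg 8 D + m) = s * (s + 1)) := by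
      intro m hm
      apply (regular_cell_iff s (8 * D) 8 D _ (by norm_num) hD rfl hs).mpr
      obtain ⟨N, k, hk, hsum, hex⟩ := rows_of_excess_eight D m (by omega) hm
      refine ⟨N, k, hk, hsum, ?_⟩
      rw [hex]
      omega
    rcases hj with rfl | rfl | rfl | rfl | ⟨hlo, hhi⟩
    · exact ((regular_cell_first_gap s (8 * D) 8 D (by norm_num) hD rfl hs).2.1)
    · exact hval 7 (by omega)
    · exact hval 12 (by omega)
    · exact hval 13 (by omega)
    · have := hval (j - bottomReg 8 D) (by omega)
      rwa [Nat.add_sub_cancel' (by omega : bottomReg 8 D ≤ j)] at this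

end C047

end TriangleCap

end PercRepro
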